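import Literature.NumberTheory.GaloisRepresentations.IdeleClassBarAbsoluteGaloisTransport
import Literature.NumberTheory.GaloisRepresentations.RestrictedRamificationUnramifiedSubfields
import Literature.NumberTheory.GaloisRepresentations.GlobalExistenceTheoremReductionProofs
import Literature.NumberTheory.GaloisRepresentations.FrobeniusDensityTheorem
import Literature.NumberTheory.GaloisRepresentations.UnitIdelesHerbrand
import Literature.NumberTheory.GaloisRepresentations.ArtinLemma
import Literature.NumberTheory.NumberFields.ScholzKummerGenerator
import HarnessLib

/-!
# A Galois extension of a layer `L ⊆ K_S` that is unramified outside `S` lies INSIDE `K_S`: the inertia groups above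
# `v ∉ S` fix it; every such extension embeds in a layer of `K_S`; characters of `Gal(E/L)`, `E ⊆ K_S`, factor through
# `S`-unramified abelian extensions of `L` (NSW VIII §3 «`(k_S)_S = k_S`»; Neukirch VII §10 proof of (10.6); C–F VII §11.1)

Topic `NumberTheory/GaloisRepresentations`; namespace `Literature.NumberTheory.GaloisRepresentations` (`IdeleClassBar` for
the layer statements).  Theorems only (no definition, no named fact, no instance, no notation, no `sorry`); number fields
in `Type`.  Sequel to `RestrictedRamificationUnramifiedSubfields.lean` (`M ⊆ K_S ⟺ M/K unramified outside S` for `M`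
Galois OVER THE BASE `K`), door-c4 g16's `GalLayer.exists_ge_nonempty_algHom` (every finite extension of a layer `L`
embeds over `L` into a layer `M ⊇ L`) and door-c4 g17's `exists_isAbelianGalois_character_factor` (a character of
`Gal(E/L)` factors through a finite abelian `K' ⊆ L̄` embedded in `E`).

THE POINT.  The group `G_S = Γ_K ⧸ N_S` has the layers `E ⊆ K_S` (`N_S ≤ Gal(K̄/E)`); at an open subgroup
`U = Gal(K_S/L)` (`L` a layer inside `K_S`) the class field theory of the `S`-idèle class formation is the class field
theory of the number field `L` for the finite abelian extensions of `L` UNRAMIFIED OUTSIDE the places above `S`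
(`GlobalReciprocityModPowersUnramifiedLayers`, `GlobalReciprocityBidualityUnramifiedLayers` — phrased, as door-c6's, with
`K' ⊆ L̄ = AlgebraicClosure L`).  The bridge «`K'/L` abelian unramified outside `S_L` ↔ `K'` embeds in a layer of `K_S`»
is NSW's `(k_S)_S = k_S`, i.e. the RELATIVE ramification criterion: for `L ⊆ K_S` and `M ⊇ L` Galois over `L` and
unramified over `K` outside `S`, every inertia group `I_𝔓 ≤ Γ_K` above `v ∉ S` (which lies in `Gal(K̄/L)`) restricts to
the inertia group of `𝔓 ∩ 𝓞_M` in `Gal(M/L)`, which is trivial (`#I = e = 1`, Mathlib `Ideal.card_inertia_eq_ramificationIdxIn`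
through the tree's `inertia_eq_bot_of_isUnramifiedIn`); hence `I_𝔓` fixes `M` pointwise, and so does `N_S` (its closed
normal closure), i.e. `M ⊆ K_S`.

* §1 Tower lemmas for number fields `K ⊆ E ⊆ M` (types): `isUnramifiedIn_tower_top` (`M/K` unramified at `v` ⟹ `M/E`
  unramified at every `w ∣ v`, Mathlib `IsUnramifiedAt.of_restrictScalars`), `isUnramifiedIn_tower_bot` (⟹ `E/K`
  unramified at `v`, Mathlib `IsUnramifiedAt.of_liesOver`), `isUnramifiedIn_of_algHom` (`K' → E` over `K` and `E/K`
  unramified at `v` ⟹ `K'/K` unramified at `v`).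
* §2 `ramificationSubgroup_le_of_forall_inertia_le` — `N_S ≤ H` for a CLOSED subgroup `H` containing the inertia groups above
  the places outside `S` (conjugation-stability of the family, `conj_mem_inertiaOutside`).
* §3 **`IdeleClassBar.smul_eq_self_of_mem_inertia_of_isUnramifiedIn`** (the relative criterion above) and
  **`IdeleClassBar.ramificationSubgroup_le_galFixing_restrictScalars`**: `N_S ≤ Gal(K̄/M)` for `M ⊇ L ⊆ K̄` Galois over
  the layer `L ⊆ K_S` and unramified over `K` outside `S`.
* §4 **`IdeleClassBar.GalLayer.exists_ge_insideKS_nonempty_algHom`**: every finite Galois `K'/L` (abstract type)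
  unramified over `K` outside `S` embeds `L`-linearly into a layer `M ⊇ L` of `K̄` WITH `M ⊆ K_S` (door-c4 g16's normal
  closure, now inside `K_S` by §3 and the normality of `N_S`).
* §5 **`IdeleClassBar.exists_isAbelianGalois_unramified_character_factor`**: for layers `L ≤ E` with `E ⊆ K_S`, every
  additive character of `Gal(E/L)` factors through a finite ABELIAN `K' ⊆ AlgebraicClosure L` embedded in `E` over `L`
  and unramified over `K` outside `S` (door-c4 g17 + §1).
* §6 `IdeleClassBar.exists_finset_forall_mem_iff_under_mem` (the places of `E` above a finite `S` form a finite set `S_E`) and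
  **`IdeleClassBar.unitIdelesOff_eq_unitIdelesOutside`**: `IdeleHerbrand.unitIdelesOff K E S = unitIdelesOutside E S_E`
  (Harari's `U_{E,S}` IS Neukirch's `U_E^{S_E}` of the number field `E`).

Cell `bsd-eis`, background lane «PT-Ш-S-TC» of crux `GoodLatticeBDPValue` (stmt-BirchSwinnertonDyer-19032), brick D2-(b)
(`adjointBijective_one_zmod_pow` for `(G_S, C̄_S)` at the open subgroups `U ≠ G_S`), seat bsd-line-x1-p1-w8 g12.
HONEST FRAMING: Galois/ramification bookkeeping; no duality theorem, no case of Poitou–Tate and no case of BSD is proved.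

## References
* J. Neukirch, A. Schmidt, K. Wingberg, *Cohomology of Number Fields*, 2nd ed. (2008), VIII §3 (`k_S`, `G_S`).
  [NeukirchSchmidtWingberg2008]
* J. Neukirch, *Algebraic Number Theory* (1999), Ch. I §9 (9.4), Ch. II (7.2)–(7.3), Ch. VII §10 proof of Thm. (10.6).
  [NeukirchANT1999]
* J. W. S. Cassels, A. Fröhlich (eds.), *Algebraic Number Theory* (1967), Ch. VII (J. Tate) §11.1. [CasselsFrohlichANT1967]
* J. Neukirch, *Class Field Theory — The Bonn Lectures* (2013), Part III §7 p. 175 (`U_K^S`). [Neukirch2013]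
-/

noncomputable section

open NumberField IsDedekindDomain
open Field (absoluteGaloisGroup)
open Literature.NumberTheory.NumberFields
open Literature.NumberTheory.GaloisRepresentations.LocalWeilDatum (galFixing mem_galFixing_iff galFixing_antitone)
open scoped Classical Pointwise

namespace Literature.NumberTheory.GaloisRepresentations

/-! ## §1. Tower lemmas -/

section Tower

variable {K : Type} [Field K] [NumberField K]

omit [NumberField K] in
/-- **Tower, top step: `M/K` unramified at `v` ⟹ `M/E` unramified at every place `w ∣ v` of `E`** (`K ⊆ E ⊆ M` number fields;
`Ω_{M/E}` is a quotient of `Ω_{M/K}`, Mathlib `Algebra.IsUnramifiedAt.of_restrictScalars`). [cite: NeukirchANT1999, Ch. II (7.2)] -/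
theorem isUnramifiedIn_tower_top (E M : Type*) [Field E] [NumberField E] [Field M] [NumberField M]
    [Algebra K E] [Algebra E M] [Algebra K M] [IsScalarTower K E M]
    {v : HeightOneSpectrum (𝓞 K)} (hM : Algebra.IsUnramifiedIn (𝓞 M) v.asIdeal)
    (w : HeightOneSpectrum (𝓞 E)) (hw : w.asIdeal.LiesOver v.asIdeal) :
    Algebra.IsUnramifiedIn (𝓞 M) w.asIdeal := by
  haveI : IsScalarTower (𝓞 K) (𝓞 E) (𝓞 M) := IsScalarTower.of_algebraMap_eq fun x =>
    Subtype.ext (IsScalarTower.algebraMap_apply K E M (x : K))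
  intro Q hQ hQw
  haveI := hQ
  haveI := hQw
  haveI := hw
  haveI : Q.LiesOver v.asIdeal := Ideal.LiesOver.trans Q w.asIdeal v.asIdeal
  haveI : Algebra.IsUnramifiedAt (𝓞 K) Q := hM Q hQ inferInstance
  exact Algebra.IsUnramifiedAt.of_restrictScalars (𝓞 K) Q

/-- **Tower, bottom step: `M/K` unramified at `v` ⟹ `E/K` unramified at `v`** (`K ⊆ E ⊆ M` number fields; `e(𝔓_E ∣ v)` divides
`e(𝔓_M ∣ v)`, Mathlib `Algebra.IsUnramifiedAt.of_liesOver`; the tree's `ArtinLemma.isUnramifiedIn_intermediateField` for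
intermediate fields). [cite: NeukirchANT1999, Ch. II (7.3)] -/
theorem isUnramifiedIn_tower_bot (E M : Type*) [Field E] [NumberField E] [Field M] [NumberField M]
    [Algebra K E] [Algebra E M] [Algebra K M] [IsScalarTower K E M]
    {v : HeightOneSpectrum (𝓞 K)} (hM : Algebra.IsUnramifiedIn (𝓞 M) v.asIdeal) :
    Algebra.IsUnramifiedIn (𝓞 E) v.asIdeal := by
  haveI : IsScalarTower (𝓞 K) (𝓞 E) (𝓞 M) := IsScalarTower.of_algebraMap_eq fun x =>
    Subtype.ext (IsScalarTower.algebraMap_apply K E M (x : K))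
  intro P hP hover
  haveI := hP
  haveI := hover
  have hPne : P ≠ ⊥ := Ideal.ne_bot_of_liesOver_of_ne_bot v.ne_bot P
  haveI : P.IsMaximal := hP.isMaximal hPne
  obtain ⟨Q, hQmax, hQover⟩ := Ideal.exists_maximal_ideal_liesOver_of_isIntegral (S := 𝓞 M) P
  haveI := hQmax.isPrime
  haveI := hQover
  haveI : Q.LiesOver v.asIdeal := Ideal.LiesOver.trans Q P v.asIdeal
  haveI : Algebra.IsUnramifiedAt (𝓞 K) Q := hM Q hQmax.isPrime inferInstance
  exact Algebra.IsUnramifiedAt.of_liesOver (𝓞 K) P Q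

/-- **An extension `K'` of `K` that embeds over `K` into a number field `E` unramified at `v` is unramified at `v`** (`K'` is
`K`-isomorphic to an intermediate field of `E/K`). [cite: NeukirchANT1999, Ch. II (7.3)] -/
theorem isUnramifiedIn_of_algHom {K' E : Type*} [Field K'] [NumberField K'] [Field E] [NumberField E] [Algebra K K']
    [Algebra K E] (ψ : K' →ₐ[K] E) {v : HeightOneSpectrum (𝓞 K)} (hE : Algebra.IsUnramifiedIn (𝓞 E) v.asIdeal) :
    Algebra.IsUnramifiedIn (𝓞 K') v.asIdeal := by
  let E₁ : IntermediateField K E := (⊤ : IntermediateField K K').map ψ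
  haveI : NumberField E₁ :=
    haveI : FiniteDimensional K E₁ := inferInstance
    NumberField.of_module_finite K E₁
  let e : K' ≃ₐ[K] E₁ := IntermediateField.topEquiv.symm.trans ((⊤ : IntermediateField K K').equivMap ψ)
  exact isUnramifiedIn_of_algEquiv_of_isUnramifiedIn e v.ne_bot (ArtinLemma.isUnramifiedIn_intermediateField E₁ hE)

end Tower

/-! ## §2. `N_S ≤ H` for a closed subgroup containing the inertia groups above the places outside `S` -/

section Closed

variable {K : Type} [Field K] {S : Set (HeightOneSpectrum (𝓞 K))}

/-- **`N_S ≤ H` for every CLOSED subgroup `H ≤ Γ_K` containing the inertia groups `I_𝔓`, `𝔓 ∣ v`, `v ∉ S`**: the family of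
these inertia groups is stable under conjugation, so its normal closure is the subgroup it generates, and `H` is closed.
[cite: NeukirchSchmidtWingberg2008, VIII §3] -/
theorem ramificationSubgroup_le_of_forall_inertia_le (H : Subgroup (absoluteGaloisGroup K))
    (hH : IsClosed (H : Set (absoluteGaloisGroup K)))
    (h : ∀ v : HeightOneSpectrum (𝓞 K), v ∉ S → ∀ 𝔓 ∈ v.primesAbove,
      𝔓.inertia (absoluteGaloisGroup K) ≤ H) :
    ramificationSubgroup K S ≤ H := by
  refine Subgroup.topologicalClosure_minimal _ ?_ hH
  refine (Subgroup.closure_le H).mpr fun x hx => ?_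
  obtain ⟨a, ha, hax⟩ := Group.mem_conjugatesOfSet_iff.mp hx
  obtain ⟨c, rfl⟩ := isConj_iff.mp hax
  obtain ⟨v, hv, 𝔓, h𝔓, ha'⟩ := mem_inertiaOutside_iff.mp ha
  exact h v hv (c • 𝔓) (smul_mem_primesAbove h𝔓 c) (conj_mem_inertia_smul ha' c)

end Closed

namespace IdeleClassBar

variable {F : Type} [Field F] [NumberField F] {S : Set (HeightOneSpectrum (𝓞 F))}

/-! ## §3. The relative criterion: inertia above `v ∉ S` fixes every `S`-unramified Galois extension of a layer of `K_S` -/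

/-- **The relative ramification criterion at a layer of `K_S`.**  Let `L ⊆ K_S` be a layer (`N_S ≤ Gal(F̄/L)`) and
`M ⊆ F̄` a finite Galois extension of `L` that is unramified OVER `F` at every `v ∉ S`.  Then for every `v ∉ S`, every
prime `𝔓 ∣ v` of `\bar ℤ_F` and every `g ∈ I_𝔓 ≤ Γ_F`: `g` fixes `M` pointwise.  (Indeed `g ∈ Gal(F̄/L)`; as an
`L`-automorphism it restricts to `M` (normal over `L`) and the restriction lies in the inertia group of `𝔓 ∩ 𝓞_M` in
`Gal(M/L)`, trivial because `M/L` is unramified above `v`: `#I = e = 1`.)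
[cite: NeukirchANT1999, Ch. VII §10 Thm. (10.6) (proof), Ch. I §9 (9.4)] [cite: NeukirchSchmidtWingberg2008, VIII §3] -/
theorem smul_eq_self_of_mem_inertia_of_isUnramifiedIn (L : GalLayer F)
    (hL : ramificationSubgroup F S ≤ galFixing F L.1) (M : IntermediateField L.1 (AlgebraicClosure F))
    [FiniteDimensional L.1 M] [IsGalois L.1 M]
    (hM : ∀ v : HeightOneSpectrum (𝓞 F), v ∉ S → Algebra.IsUnramifiedIn (𝓞 M) v.asIdeal)
    {v : HeightOneSpectrum (𝓞 F)} (hv : v ∉ S) {𝔓 : Ideal (absIntegers (𝓞 F) F)} (h𝔓 : 𝔓 ∈ v.primesAbove)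
    {g : absoluteGaloisGroup F} (hg : g ∈ 𝔓.inertia (absoluteGaloisGroup F)) {x : AlgebraicClosure F} (hx : x ∈ M) :
    g • x = x := by
  haveI := L.finiteDimensional
  haveI := L.numberField
  haveI : NumberField M := NumberField.of_module_finite L.1 M
  haveI : IsScalarTower F L.1 M := IsScalarTower.of_algebraMap_eq fun r => Subtype.ext rfl
  haveI : IsScalarTower F M (AlgebraicClosure F) := IsScalarTower.of_algebraMap_eq fun r => rfl
  haveI : IsScalarTower (𝓞 F) (𝓞 L.1) (𝓞 M) := IsScalarTower.of_algebraMap_eq fun r =>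
    Subtype.ext (IsScalarTower.algebraMap_apply F L.1 M (r : F))
  haveI := h𝔓.1
  -- `g` fixes `L`, hence is an `L`-automorphism of `F̄`
  have hgL : g ∈ galFixing F L.1 := hL (inertia_le_ramificationSubgroup hv h𝔓 hg)
  let gL : AlgebraicClosure F ≃ₐ[L.1] AlgebraicClosure F :=
    { (absoluteGaloisGroup.toAlgEquiv F g : AlgebraicClosure F ≃+* AlgebraicClosure F) with
      commutes' := fun l => (mem_galFixing_iff F).mp hgL l l.2 }
  have hgL_apply : ∀ y : AlgebraicClosure F, gL y = g • y := fun y => rfl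
  -- its restriction to `M`, an element of the inertia group of `𝔓 ∩ 𝓞_M` in `Gal(M/L)`; first `ι : 𝓞 M → \bar ℤ_F`
  let ι : 𝓞 M →+* absIntegers (𝓞 F) F :=
    ((algebraMap M (AlgebraicClosure F)).comp (algebraMap (𝓞 M) M)).codRestrict (absIntegers (𝓞 F) F) fun x => by
      rw [mem_integralClosure_iff]
      have hx : IsIntegral ℤ (algebraMap M (AlgebraicClosure F) (algebraMap (𝓞 M) M x)) :=
        (RingOfIntegers.isIntegral_coe x).map (IsScalarTower.toAlgHom ℤ M (AlgebraicClosure F))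
      exact hx.tower_top
  have hι : ∀ y : 𝓞 M, (ι y : AlgebraicClosure F) = ((y : M) : AlgebraicClosure F) := fun y => rfl
  let P : Ideal (𝓞 M) := 𝔓.comap ι
  haveI hP : P.IsPrime := Ideal.comap_isPrime ι 𝔓
  have hιalg : ∀ r : 𝓞 F, ι (algebraMap (𝓞 F) (𝓞 M) r) = algebraMap (𝓞 F) (absIntegers (𝓞 F) F) r := fun r => by
    apply Subtype.ext
    rw [hι]
    change ((algebraMap F M (r : F) : M) : AlgebraicClosure F) = algebraMap F (AlgebraicClosure F) (r : F)
    exact (IsScalarTower.algebraMap_apply F M (AlgebraicClosure F) (r : F)).symm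
  have hPF : P.under (𝓞 F) = v.asIdeal := by
    rw [h𝔓.2.over]
    ext r
    rw [Ideal.under_def, Ideal.under_def, Ideal.mem_comap, Ideal.mem_comap, Ideal.mem_comap, hιalg]
  -- the place `w = P ∩ 𝓞_L` of `L` below `P`, which lies above `v`
  have hw0 : P.under (𝓞 L.1) ≠ ⊥ := by
    intro h0
    apply v.ne_bot
    have h1 : (P.under (𝓞 L.1)).under (𝓞 F) = v.asIdeal := by rw [Ideal.under_under]; exact hPF
    rw [h0, Ideal.under_def, Ideal.comap_bot_of_injective (algebraMap (𝓞 F) (𝓞 L.1))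
      (FaithfulSMul.algebraMap_injective (𝓞 F) (𝓞 L.1))] at h1
    exact h1.symm
  let w : HeightOneSpectrum (𝓞 L.1) := ⟨P.under (𝓞 L.1), Ideal.IsPrime.under (𝓞 L.1) P, hw0⟩
  haveI hwv : w.asIdeal.LiesOver v.asIdeal := ⟨by rw [Ideal.under_under (A := 𝓞 F) (B := 𝓞 L.1) P]; exact hPF.symm⟩
  have hunr : Algebra.IsUnramifiedIn (𝓞 M) w.asIdeal := isUnramifiedIn_tower_top L.1 M (hM v hv) w hwv
  have hbot : P.inertia (M ≃ₐ[L.1] M) = ⊥ := inertia_eq_bot_of_isUnramifiedIn hunr ⟨hP, ⟨rfl⟩⟩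
  have hmem : gL.restrictNormal M ∈ P.inertia (M ≃ₐ[L.1] M) := by
    intro y
    change ι (gL.restrictNormal M • y - y) ∈ 𝔓
    rw [map_sub]
    have h1 : ι (gL.restrictNormal M • y) = g • ι y := by
      apply Subtype.ext
      rw [integralClosure.coe_smul, hι, hι, ← hgL_apply]
      change ((gL.restrictNormal M (y : M) : M) : AlgebraicClosure F) = gL ((y : M) : AlgebraicClosure F)
      exact AlgEquiv.restrictNormal_commutes gL M (y : M)
    rw [h1]
    exact hg (ι y)
  rw [hbot, Subgroup.mem_bot] at hmem
  have h2 := (AlgEquiv.restrictNormal_eq_one_iff M gL).mp hmem x hx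
  rwa [hgL_apply] at h2

/-- **`N_S ≤ Gal(F̄/M)`** for `M ⊆ F̄` finite Galois over a layer `L ⊆ K_S` and unramified over `F` outside `S` — «`M ⊆ K_S`»:
the maximal extension of `L` unramified outside the places above `S` is `K_S` itself (NSW: `(k_S)_S = k_S`).
[cite: NeukirchSchmidtWingberg2008, VIII §3] [cite: NeukirchANT1999, Ch. VII §10 Thm. (10.6) (proof)] -/
theorem ramificationSubgroup_le_galFixing_restrictScalars (L : GalLayer F)
    (hL : ramificationSubgroup F S ≤ galFixing F L.1) (M : IntermediateField L.1 (AlgebraicClosure F))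
    [FiniteDimensional L.1 M] [IsGalois L.1 M]
    (hM : ∀ v : HeightOneSpectrum (𝓞 F), v ∉ S → Algebra.IsUnramifiedIn (𝓞 M) v.asIdeal) :
    ramificationSubgroup F S ≤ galFixing F (M.restrictScalars F) := by
  refine ramificationSubgroup_le_of_forall_inertia_le _ (LocalWeilDatum.isClosed_galFixing F _)
    fun v hv 𝔓 h𝔓 g hg => ?_
  rw [mem_galFixing_iff]
  intro x hx
  exact smul_eq_self_of_mem_inertia_of_isUnramifiedIn L hL M hM hv h𝔓 hg hx

/-! ## §4. Every `S`-unramified Galois extension of a layer of `K_S` embeds in a layer of `K_S` -/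

omit [NumberField F] in
/-- An automorphism fixing a point fixes it under all its integer powers (auxiliary). [folklore] -/
private theorem zpow_apply_eq_self {E : Type*} [Field E] [Algebra F E] (σ : E ≃ₐ[F] E) {x : E} (hx : σ x = x) (k : ℤ) :
    (σ ^ k) x = x := by
  have hmem : Subgroup.zpowers σ ≤ MulAction.stabilizer (E ≃ₐ[F] E) x :=
    (Subgroup.zpowers_le (G := E ≃ₐ[F] E)).mpr (MulAction.mem_stabilizer_iff.mpr hx)
  exact MulAction.mem_stabilizer_iff.mp (hmem (Subgroup.mem_zpowers_iff.mpr ⟨k, rfl⟩))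

/-- **Every finite Galois extension `K'` of a layer `L ⊆ K_S` that is unramified over `F` outside `S` embeds `L`-linearly
into a layer `M ⊇ L` of `F̄` lying INSIDE `K_S`** (`N_S ≤ Gal(F̄/M)`).  As in door-c4 g16's `exists_ge_nonempty_algHom`,
`M` is the normal closure over `F` of an `L`-embedded copy `K'' ⊆ F̄` of `K'`; `N_S` fixes `K''` (§3) and is normal in `Γ_F`,
so it fixes every conjugate `σ(K'')`, whose compositum is `M`.
[cite: NeukirchSchmidtWingberg2008, VIII §3] [cite: CasselsFrohlichANT1967, Ch. VII §11.1] -/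
theorem GalLayer.exists_ge_insideKS_nonempty_algHom (L : GalLayer F) (hL : ramificationSubgroup F S ≤ galFixing F L.1)
    (K' : Type) [Field K'] [Algebra L.1 K'] [Algebra F K'] [IsScalarTower F L.1 K'] [FiniteDimensional L.1 K']
    [IsGalois L.1 K'] (hK' : ∀ v : HeightOneSpectrum (𝓞 F), v ∉ S → Algebra.IsUnramifiedIn (𝓞 K') v.asIdeal) :
    ∃ (M : GalLayer F) (h : L ≤ M), ramificationSubgroup F S ≤ galFixing F M.1 ∧
      Nonempty (letI := GalLayer.algebraOfLE h; K' →ₐ[L.1] M.1) := by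
  haveI := L.finiteDimensional
  haveI := L.numberField
  haveI : FiniteDimensional F K' := Module.Finite.trans L.1 K'
  haveI : NumberField K' := NumberField.of_module_finite F K'
  haveI : Algebra.IsAlgebraic L.1 K' := Algebra.IsAlgebraic.of_finite L.1 K'
  -- embed `K'` into `F̄` over `L`; its image `K''` is Galois over `L` and unramified over `F` outside `S`
  let φ : K' →ₐ[L.1] AlgebraicClosure F := IsAlgClosed.lift
  let K'' : IntermediateField L.1 (AlgebraicClosure F) := (⊤ : IntermediateField L.1 K').map φ
  let e : K' ≃ₐ[L.1] K'' := IntermediateField.topEquiv.symm.trans ((⊤ : IntermediateField L.1 K').equivMap φ)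
  haveI : FiniteDimensional L.1 K'' := LinearEquiv.finiteDimensional e.toLinearEquiv
  haveI : IsGalois L.1 K'' := IsGalois.of_algEquiv e
  haveI : NumberField K'' := NumberField.of_module_finite L.1 K''
  haveI : IsScalarTower F L.1 K'' := IsScalarTower.of_algebraMap_eq fun r => Subtype.ext rfl
  have hK'' : ∀ v : HeightOneSpectrum (𝓞 F), v ∉ S → Algebra.IsUnramifiedIn (𝓞 K'') v.asIdeal := fun v hv =>
    isUnramifiedIn_of_algEquiv_of_isUnramifiedIn (e.symm.restrictScalars F) v.ne_bot (hK' v hv)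
  have hφK'' : ∀ k : K', φ k ∈ K'' := fun k => ⟨k, IntermediateField.mem_top, rfl⟩
  -- the normal closure over `F` of `K''` (the same subfield, now over `F`)
  let K₄ : IntermediateField F (AlgebraicClosure F) := (⊤ : IntermediateField F K').map (φ.restrictScalars F)
  let e₄ : K' ≃ₐ[F] K₄ :=
    IntermediateField.topEquiv.symm.trans ((⊤ : IntermediateField F K').equivMap (φ.restrictScalars F))
  haveI : FiniteDimensional F K₄ := LinearEquiv.finiteDimensional e₄.toLinearEquiv
  have hK₄K'' : ∀ y ∈ K₄, y ∈ K'' := by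
    rintro _ ⟨k, -, rfl⟩
    exact hφK'' k
  have hφK₄ : ∀ k : K', φ k ∈ K₄ := fun k => ⟨k, IntermediateField.mem_top, rfl⟩
  let M₀ : IntermediateField F (AlgebraicClosure F) := IntermediateField.normalClosure F K₄ (AlgebraicClosure F)
  haveI : FiniteDimensional F M₀ := normalClosure.is_finiteDimensional F K₄ (AlgebraicClosure F)
  haveI : Algebra.IsSeparable F M₀ := Algebra.IsAlgebraic.isSeparable_of_perfectField (K := F) (L := M₀)
  haveI : IsGalois F M₀ := isGalois_iff.2 ⟨inferInstance, inferInstance⟩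
  have hK₄M : K₄ ≤ M₀ := IntermediateField.le_normalClosure K₄
  let M : GalLayer F := ⟨M₀, inferInstance, inferInstance⟩
  have hle : L ≤ M := fun x hx => by
    have h1 := hφK₄ (algebraMap L.1 K' ⟨x, hx⟩)
    rw [AlgHom.commutes] at h1
    exact hK₄M h1
  -- `N_S` fixes `K''` (§3), hence every conjugate `σ(K'')`, hence `M₀`
  have hfixK : ramificationSubgroup F S ≤ galFixing F (K''.restrictScalars F) :=
    ramificationSubgroup_le_galFixing_restrictScalars L hL K'' hK''
  have hfix : ramificationSubgroup F S ≤ galFixing F M.1 := by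
    intro n hn
    rw [mem_galFixing_iff]
    intro x hx
    change x ∈ IntermediateField.normalClosure F K₄ (AlgebraicClosure F) at hx
    rw [IntermediateField.normalClosure_def''] at hx
    have hle' : (⨆ f : AlgebraicClosure F ≃ₐ[F] AlgebraicClosure F, K₄.map f) ≤
        IntermediateField.fixedField (Subgroup.zpowers (absoluteGaloisGroup.toAlgEquiv F n)) := by
      refine iSup_le fun f => ?_
      rintro _ ⟨y, hy, rfl⟩
      rw [IntermediateField.mem_fixedField_iff]
      intro h hh
      obtain ⟨k, rfl⟩ := Subgroup.mem_zpowers_iff.mp hh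
      refine zpow_apply_eq_self _ ?_ k
      -- `n (f y) = f ((f⁻¹ n f) y) = f y` since `f⁻¹ n f ∈ N_S` fixes `K''`
      let f' : absoluteGaloisGroup F := (absoluteGaloisGroup.toAlgEquiv F).symm f
      have hf' : ∀ z : AlgebraicClosure F, f' • z = f z := fun z => rfl
      have hconj : f'⁻¹ * n * f' ∈ ramificationSubgroup F S := by
        have := (ramificationSubgroup_normal F S).conj_mem n hn f'⁻¹
        rwa [inv_inv] at this
      have h2 : (f'⁻¹ * n * f') • y = y := (mem_galFixing_iff F).mp (hfixK hconj) y (hK₄K'' y hy)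
      have h3 : n • f' • y = f' • y := by
        have h4 := congrArg (fun z => f' • z) h2
        rwa [smul_smul, mul_assoc, mul_inv_cancel_left, ← smul_smul] at h4
      rw [hf'] at h3
      exact h3
    have hx' := hle' hx
    rw [IntermediateField.mem_fixedField_iff] at hx'
    exact hx' _ (Subgroup.mem_zpowers _)
  refine ⟨M, hle, hfix, ⟨?_⟩⟩
  letI := GalLayer.algebraOfLE hle
  exact
    { toFun := fun k => ⟨φ k, hK₄M (hφK₄ k)⟩
      map_one' := Subtype.ext (map_one φ)
      map_mul' := fun a b => Subtype.ext (map_mul φ a b)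
      map_zero' := Subtype.ext (map_zero φ)
      map_add' := fun a b => Subtype.ext (map_add φ a b)
      commutes' := fun r => Subtype.ext (φ.commutes r) }

/-! ## §5. Characters of `Gal(E/L)`, `E ⊆ K_S`, factor through `S`-unramified abelian extensions of `L` -/

/-- **A layer of `K_S` is unramified over `F` outside `S`** (the tree's `isUnramifiedIn_of_ramificationSubgroup_le_fixingSubgroup`
in the `galFixing` spelling). [cite: NeukirchSchmidtWingberg2008, VIII §3] -/
theorem GalLayer.isUnramifiedIn_of_insideKS (E : GalLayer F) (hE : ramificationSubgroup F S ≤ galFixing F E.1)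
    {v : HeightOneSpectrum (𝓞 F)} (hv : v ∉ S) :
    haveI := E.numberField; Algebra.IsUnramifiedIn (𝓞 E.1) v.asIdeal := by
  haveI := E.numberField
  haveI := E.isGalois
  exact isUnramifiedIn_of_ramificationSubgroup_le_fixingSubgroup E.1 hE hv

set_option maxHeartbeats 400000 in
/-- **Every additive character of `Gal(E/L)` (`L ≤ E` layers, `E ⊆ K_S`) factors through a finite ABELIAN extension
`K' ⊆ AlgebraicClosure L` of `L`, embedded in `E` over `L` and UNRAMIFIED over `F` outside `S`** (door-c4 g17's
`exists_isAbelianGalois_character_factor`: `K' ≅ E^{ker χ}`; unramified as a subextension of `E/F`, §1).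
[cite: CasselsFrohlichANT1967, Ch. VII §11.1] [cite: NeukirchANT1999, Ch. II (7.3)] -/
theorem exists_isAbelianGalois_unramified_character_factor {L E : GalLayer F} [Algebra L.1 E.1]
    [IsScalarTower F L.1 E.1] [FiniteDimensional L.1 E.1] [IsGalois L.1 E.1]
    (hE : ramificationSubgroup F S ≤ galFixing F E.1) {A : Type} [AddCommGroup A]
    (χ : Additive (E.1 ≃ₐ[L.1] E.1) →+ A) :
    ∃ (K' : IntermediateField L.1 (AlgebraicClosure L.1)) (_ : FiniteDimensional L.1 K') (_ : IsAbelianGalois L.1 K')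
      (ψ : K' →ₐ[L.1] E.1) (χK : Additive (K' ≃ₐ[L.1] K') →+ A),
      (∀ v : HeightOneSpectrum (𝓞 F), v ∉ S → Algebra.IsUnramifiedIn (𝓞 K') v.asIdeal) ∧
      (letI : Algebra K' E.1 := ψ.toRingHom.toAlgebra
       haveI : IsScalarTower L.1 K' E.1 := IsScalarTower.of_algebraMap_eq fun r => (ψ.commutes r).symm
       χ = χK.comp (MonoidHom.toAdditive (AlgEquiv.restrictNormalHom K'))) := by
  haveI := L.numberField
  haveI := E.numberField
  have hfac := exists_isAbelianGalois_character_factor (L := L.1) (E := E.1) (Ω := AlgebraicClosure L.1) (A := A) χ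
  obtain ⟨K', hfd, hab, ψ, χK, hχ⟩ := hfac
  haveI := hfd
  haveI : NumberField K' := NumberField.of_module_finite L.1 K'
  refine ⟨K', hfd, hab, ψ, χK, fun v hv => ?_, hχ⟩
  exact isUnramifiedIn_of_algHom (ψ.restrictScalars F) (GalLayer.isUnramifiedIn_of_insideKS E hE hv)

/-! ## §6. `U_{E,S}` (Harari) is `U_E^{S_E}` (Neukirch) for the finite set `S_E` of places of `E` above `S` -/

/-- **The places of `E` above a finite set `S` of places of `K` form a finite set.** [cite: NeukirchANT1999, Ch. I §9] -/
theorem exists_finset_forall_mem_iff_under_mem {K : Type} [Field K] [NumberField K] (E : Type) [Field E] [NumberField E]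
    [Algebra K E] (S : Finset (HeightOneSpectrum (𝓞 K))) :
    ∃ T : Finset (HeightOneSpectrum (𝓞 E)), ∀ w : HeightOneSpectrum (𝓞 E), w ∈ T ↔ w.under (𝓞 K) ∈ S := by
  have hfin : Set.Finite {w : HeightOneSpectrum (𝓞 E) | w.under (𝓞 K) ∈ S} := by
    have heq : {w : HeightOneSpectrum (𝓞 E) | w.under (𝓞 K) ∈ S} =
        ⋃ v ∈ (S : Set (HeightOneSpectrum (𝓞 K))), {w : HeightOneSpectrum (𝓞 E) | w.under (𝓞 K) = v} := by
      ext w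
      simp only [Set.mem_setOf_eq, Set.mem_iUnion, Finset.mem_coe, exists_prop, exists_eq_right']
    rw [heq]
    refine Set.Finite.biUnion S.finite_toSet fun v _ => ?_
    have hinj : Set.InjOn (fun w : HeightOneSpectrum (𝓞 E) => w.asIdeal) {w | w.under (𝓞 K) = v} :=
      fun a _ b _ hab => HeightOneSpectrum.ext hab
    refine Set.Finite.of_finite_image ?_ hinj
    refine (IsDedekindDomain.primesOver_finite v.asIdeal (𝓞 E)).subset ?_
    rintro _ ⟨w, hw, rfl⟩
    refine ⟨w.isPrime, ⟨?_⟩⟩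
    rw [← hw]
    rfl
  refine ⟨hfin.toFinset, fun w => ?_⟩
  rw [Set.Finite.mem_toFinset]
  rfl

/-- **`U_{E,S} = U_E^{S_E}`**: Harari's unit idèles of `E` off the places above `S` (`IdeleHerbrand.unitIdelesOff K E S`) are
Neukirch's `U_E^{S_E}` (`unitIdelesOutside E S_E`) for the finite set `S_E` of places of `E` above `S`.
[cite: Harari2020, Def. 15.38] [cite: Neukirch2013, Part III §7, p. 175] -/
theorem unitIdelesOff_eq_unitIdelesOutside {K : Type} [Field K] [NumberField K] {E : Type} [Field E] [NumberField E]
    [Algebra K E] (S : Finset (HeightOneSpectrum (𝓞 K))) (T : Finset (HeightOneSpectrum (𝓞 E)))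
    (hT : ∀ w : HeightOneSpectrum (𝓞 E), w ∈ T ↔ w.under (𝓞 K) ∈ S) :
    IdeleHerbrand.unitIdelesOff K E S = unitIdelesOutside E T := by
  ext x
  rw [mem_unitIdelesOutside_iff]
  constructor
  · rintro ⟨hu, h1, hS⟩
    exact ⟨h1, fun w hw => hS w ((hT w).mp hw), fun w => hu w⟩
  · rintro ⟨h1, hT', hu⟩
    exact ⟨fun w => hu w, h1, fun w hw => hT' w ((hT w).mpr hw)⟩

end IdeleClassBar

end Literature.NumberTheory.GaloisRepresentations

end
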